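import Literature.NumberTheory.Automorphic.LocalUnitaryGroupSimilitudeLevel
import Literature.NumberTheory.Rogawski1990.CMLocalAPacketMembers
import HarnessLib

/-!
# Level matching at almost every NON-SPLIT place by a FORM CONGRUENCE over `E ⊗_F F_v`: a similitude
# `T ∈ GL_N(E_v)` with `ᵗ((c ⊗ 1) T) · J_v · T = Φ_N` whose conjugation `g ↦ T⁻¹ g T` carries `U(J)(𝒪_v)` onto `U(Φ_N)(𝒪_v)`
(Rogawski (1990), §14.2 p. 233 «for `v ∉ S₀ ∪ S`, `K_v ≃ K′_v`»; Jacobowitz (1962), §7 Thm. 7.1; Platonov–Rapinchuk (1994), §2.3, §5.1)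

Topic `NumberTheory/Automorphic`; namespace `Literature.NumberTheory.Automorphic.UnitaryGroup`.  THEOREMS ONLY (no definition, no
instance, no named fact, no notation, no `sorry`).  Sequel to ★ `LocalUnitaryGroupSimilitudeLevel` (§3 there: at a good non-split place the
one-place transport ★ `localNonsplitCongr … T` of the integral hyperbolic basis is conjugation by the regrouped `T̃` and matches the levels —
but it is not exhibited as a ★ `localFormCongr`, i.e. the form equation of `T̃` over `E_v = Π_{w ∣ v} E_w` is not stated) and ★
`LocalUnitaryIntegralLevel` (`eventually_exists_continuousMulEquiv_localIntegralLevel_iff`: an ABSTRACT `ψ`).  Cell `hodgecm-mathlib`,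
FLOOR 0 ∕ P3 rung 4, (G2) of F0P3-p01 (g7)'s `xiFamilyOfRecord` (RULING (V24)(c)): the non-split clause of ★ D6
`OneDimAutRepH.IsXiLocalFamily` (`Rogawski1990/GlobalAPacketMembership`) quantifies the identification `U(H)(L⁺_v) ≃ U(Φ₃)(L⁺_v)` IN THE
SHAPE `(cmDatumLocalCongr L v T ha h).symm` — a form congruence over `L ⊗ L⁺_v` — and the 𝔠₀ fold needs it LEVEL-MATCHING at almost
every non-split `v`; this file supplies exactly that binder.  `--supports stmt-HodgeConjecture-24833`; HC_CM is proved only modulo the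
printed citations until rung 0 closes.

## What is formalised (`E/F` CM-type quadratic, `c ≠ 1`, `J ∈ M_N(E)` `c`-hermitian, `Φ_N` the literal `Matrix.of fun i j => [i + j + 1 = N]`)
* §1 `formCongr_localGLPiEquiv_symm_localGLPiEvalEquiv_symm` — at a non-split place (`c • w = w`), the REGROUPED one-place matrix
  `T̃ = localGLPiEquiv⁻¹ (localGLPiEvalEquiv⁻¹ S)` of `S ∈ GL_N(E_w)` with `ᵗ(σ_w S) · J_w · S = J'_w` satisfies the Π-carrier form equation
  `ᵗ((c ⊗ 1) T̃) · J_v · T̃ = 1 • J'_v` (componentwise: ★ `formCongr_localGLPiEquiv_symm_map_eval`, the `c⁻¹ w = w` transport ★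
  `map_galAdicCompletionMap_congr_place`, ★ `localForm_map_eval`).
* §2 **`exists_localFormCongr_levelMatching_of_smul_eq`** — `v` unramified in `E`, `c • w = w`, `J_w ∈ GL_N(𝒪_w)`: there are
  `T ∈ GL_N(E_v)`, a unit `a` (`= 1`) and `h : ᵗ((c ⊗ 1) T) J_v T = a • (Φ_N)_v` with `T` componentwise integral and
  `(localFormCongr c v T ha h).symm g ∈ U(Φ_N)(𝒪_v) ↔ g ∈ U(J)(𝒪_v)` (the integral hyperbolic basis ★
  `exists_glInt_placeForm_eq_formCongr_antidiagonal_of_isUnramifiedIn`, inverted, regrouped by §1; levels by ★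
  `localFormCongr_symm_mem_localIntegralLevel_iff`); `eventually_forall_smul_eq_exists_localFormCongr_levelMatching` — the same for almost
  every `v` (exceptions: `v` ramified in `E` or `J_w ∉ GL_N(𝒪_w)`, ★ `eventually_forall_unit_placeForm_mem_glInt`).
* §3 CM dress (`F = L⁺`, `E = L`, `c` = complex conjugation): **`eventually_exists_cmDatumLocalCongr_levelMatching (hH) (hHd) :
  ∀ᶠ v in cofinite, (∀ w ∣ v, c • w = w) → ∃ T a ha h, ∀ g, (cmDatumLocalCongr L v T ha h).symm g ∈ cmLocalIntegralLevel L N Φ_N v ↔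
  g ∈ cmLocalIntegralLevel L N H v`** — token for token the `∃ (T) (a) (ha) (h)` prefix of the non-split clause of ★ `IsXiLocalFamily`;
  `…_levelMatching'` records the componentwise integrality of `T` as well; `…_levelMatching_three` is the `N = 3` spelling with ★ `Rogawski1990.qsForm`.

## Mathlib / tree search
Tree (★, by name): `LocalUnitaryGroupSimilitudeLevel` (`localFormCongr_symm_mem_localIntegralLevel_iff`, `exists_conj_levelMatching_of_smul_eq` —
the same mathematics with the conjugator behind an `∃ S`), `LocalUnitaryGroupSimilitude` (`formCongr_localGLPiEquiv_symm_map_eval`),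
`LocalUnitaryGroupCongr` (`localFormCongr`, `coe_localFormCongr_symm_apply`, `localGLPiEvalEquiv`, `cmDatumLocalCongr`), `LocalUnitaryIntegralLevel`
(`localIntegralLevel`, `cmLocalIntegralLevel`, `placeForm_antidiagOne`, `eventually_forall_unit_placeForm_mem_glInt`), `UnitaryGroupInertPlaceHyperbolicBasisDyadic`
(`exists_glInt_placeForm_eq_formCongr_antidiagonal_of_isUnramifiedIn`), `UnitaryGroupFormTransport` (`formCongr_inv_formCongr`), `UnitaryGroupSplitPlace`
(`map_galAdicCompletionMap_congr_place`), `UnitaryGroupNonsplitPlace` (`PlacesOver.subsingleton_of_smul_eq`, `galInv_eq_self_of_smul_eq`),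
`UnitaryGroupLocalCongr` (`adelicForm_map_adeleToLocal`).  `lean search 'cmDatumLocalCongr.*IntegralLevel|levelMatching.*formCongr'`: nothing.

## References
* [Rogawski1990] J. Rogawski, *Automorphic Representations of Unitary Groups in Three Variables* (1990), §14.2 p. 233.
* [Jacobowitz1962] R. Jacobowitz, *Hermitian forms over local fields*, Amer. J. Math. 84 (1962), §7 Thm. 7.1.
* [PlatonovRapinchuk1994] V. Platonov, A. Rapinchuk, *Algebraic Groups and Number Theory* (1994), §2.3, §5.1.
-/

set_option autoImplicit false

noncomputable section

open NumberField IsDedekindDomain Filter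
open scoped Matrix MatrixGroups

namespace Literature.NumberTheory.Automorphic

namespace UnitaryGroup

section Generic

variable {F E : Type} [Field F] [NumberField F] [Field E] [NumberField E] [Algebra F E]
  [Algebra.IsQuadraticExtension F E] (c : E ≃ₐ[F] E) {N : ℕ} {J J' : Matrix (Fin N) (Fin N) E} {v : HeightOneSpectrum (𝓞 F)}

/-! ## §1 The regrouped one-place similitude satisfies the form equation over `E_v = Π_{w ∣ v} E_w` -/

/-- **Regrouping a one-place similitude at a non-split place**: for `c • w = w` (so `w` is the only place of `E` above `v`) and
`S ∈ GL_N(E_w)` with `ᵗ(σ_w S) · J_w · S = J'_w`, the regrouped matrix `T̃ = localGLPiEquiv⁻¹ (localGLPiEvalEquiv⁻¹ S) ∈ GL_N(E_v)` satisfies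
`ᵗ((c ⊗ 1) T̃) · J_v · T̃ = 1 • J'_v` over `E_v = E ⊗_F F_v` (the hypothesis shape of ★ `localFormCongr` ∕ ★ `cmDatumLocalCongr`).
[cite: PlatonovRapinchuk1994, §2.3, §5.1] -/
theorem formCongr_localGLPiEquiv_symm_localGLPiEvalEquiv_symm (hc : c ≠ 1) (w : PlacesOver E v) (hw : c • w.1 = w.1)
    (S : GL (Fin N) (w.1.adicCompletion E))
    (h : formCongr (galAdicCompletionMap (L := E) c hw) S (placeForm J w.1) = placeForm J' w.1) :
    formCongr (conjLocal E c v) ((localGLPiEquiv E N v).symm ((localGLPiEvalEquiv c N hc w hw).symm S))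
        (J.map (algebraMap E (LocalRing E v))) =
      (1 : LocalRing E v) • J'.map (algebraMap E (LocalRing E v)) := by
  haveI : Subsingleton (PlacesOver E v) := PlacesOver.subsingleton_of_smul_eq c hc w hw
  rw [one_smul, ← adelicForm_map_adeleToLocal E v J, ← adelicForm_map_adeleToLocal E v J', Matrix.eq_iff_forall_map_evalRingHom]
  intro w'
  obtain rfl : w = w' := Subsingleton.elim w w'
  rw [formCongr_localGLPiEquiv_symm_map_eval, localForm_map_eval]
  -- transport the `c⁻¹ w`-component to the `w`-component (`c⁻¹ w = w`)
  have hgal : (((localGLPiEvalEquiv c N hc w hw).symm S (PlacesOver.galInv c w) :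
          GL (Fin N) ((PlacesOver.galInv c w).1.adicCompletion E)) :
          Matrix (Fin N) (Fin N) ((PlacesOver.galInv c w).1.adicCompletion E)).map
        (galAdicCompletionMap c (smul_inv_smul c w.1)) =
      (((localGLPiEvalEquiv c N hc w hw).symm S w : GL (Fin N) (w.1.adicCompletion E)) :
          Matrix (Fin N) (Fin N) (w.1.adicCompletion E)).map (galAdicCompletionMap (L := E) c hw) :=
    congrArg (fun g : GL (Fin N) (w.1.adicCompletion E) => (g : Matrix (Fin N) (Fin N) (w.1.adicCompletion E)))
      (map_galAdicCompletionMap_congr_place (PlacesOver.galInv_eq_self_of_smul_eq c w hw) (smul_inv_smul c w.1) hw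
        ((localGLPiEvalEquiv c N hc w hw).symm S))
  rw [hgal, localGLPiEvalEquiv_symm_apply_self]
  exact h

/-! ## §2 Level matching by a form congruence at a good non-split place, and at almost every place -/

/-- **LEVEL MATCHING BY A FORM CONGRUENCE at an unramified non-split place.**  `c ≠ 1`, `J` `c`-hermitian, `w ∣ v` with `c • w = w`, `v`
unramified in `E`, `J_w ∈ GL_N(𝒪_w)`: the integral hyperbolic basis `S ∈ GL_N(𝒪_w)` with `J_w = ᵗσ_w(S) · Φ_N · S` ([Jacobowitz1962, §7 Thm. 7.1];
★ `exists_glInt_placeForm_eq_formCongr_antidiagonal_of_isUnramifiedIn`), inverted and regrouped, is a similitude `T ∈ GL_N(E_v)`, componentwise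
integral, with `ᵗ((c ⊗ 1) T) · J_v · T = 1 • (Φ_N)_v`, and `g ↦ T⁻¹ g T` (★ `localFormCongr … .symm`) carries `U(J)(𝒪_v)` onto `U(Φ_N)(𝒪_v)`.
[cite: Rogawski1990, §14.2 p. 233] [cite: Jacobowitz1962, §7 Thm. 7.1] -/
theorem exists_localFormCongr_levelMatching_of_smul_eq (hc : c ≠ 1) (hJh : (J.map c)ᵀ = J) (w : PlacesOver E v)
    (hw : c • w.1 = w.1) (hv : Algebra.IsUnramifiedIn (𝓞 E) v.asIdeal) (hJw : IsUnit (placeForm J w.1))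
    (hJi : hJw.unit ∈ glInt N (w.1.adicCompletion E)) :
    ∃ (T : GL (Fin N) (LocalRing E v)) (a : LocalRing E v) (ha : IsUnit a)
      (h : formCongr (conjLocal E c v) T (J.map (algebraMap E (LocalRing E v))) =
        a • (Matrix.of fun i j : Fin N => if i.val + j.val + 1 = N then (1 : E) else 0).map (algebraMap E (LocalRing E v))),
      (∀ w' : PlacesOver E v, localGLPiEquiv E N v T w' ∈ glInt N (w'.1.adicCompletion E)) ∧
      ∀ g : «local» E c N J v,
        (localFormCongr c v T ha h).symm g ∈
            localIntegralLevel c N (Matrix.of fun i j : Fin N => if i.val + j.val + 1 = N then (1 : E) else 0) v ↔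
          g ∈ localIntegralLevel c N J v := by
  obtain ⟨S, hS, hJS⟩ := exists_glInt_placeForm_eq_formCongr_antidiagonal_of_isUnramifiedIn F E c hc N J hJh v w hw hv hJw hJi
  -- `S⁻¹` takes `J_w` to `Φ_N = (Φ_N)_w`
  have hS' : formCongr (galAdicCompletionMap (L := E) c hw) S⁻¹ (placeForm J w.1) =
      placeForm (Matrix.of fun i j : Fin N => if i.val + j.val + 1 = N then (1 : E) else 0) w.1 := by
    rw [hJS, formCongr_inv_formCongr, placeForm_antidiagOne]
  have hTint : ∀ w' : PlacesOver E v,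
      localGLPiEquiv E N v ((localGLPiEquiv E N v).symm ((localGLPiEvalEquiv c N hc w hw).symm S⁻¹)) w' ∈
        glInt N (w'.1.adicCompletion E) := by
    haveI : Subsingleton (PlacesOver E v) := PlacesOver.subsingleton_of_smul_eq c hc w hw
    intro w'
    obtain rfl : w = w' := Subsingleton.elim w w'
    rw [ContinuousMulEquiv.apply_symm_apply, localGLPiEvalEquiv_symm_apply_self]
    exact inv_mem hS
  exact ⟨(localGLPiEquiv E N v).symm ((localGLPiEvalEquiv c N hc w hw).symm S⁻¹), 1, isUnit_one,
    formCongr_localGLPiEquiv_symm_localGLPiEvalEquiv_symm c hc w hw S⁻¹ hS', hTint,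
    fun g => localFormCongr_symm_mem_localIntegralLevel_iff c v _ isUnit_one _ hTint g⟩

omit [Algebra.IsQuadraticExtension F E] in
/-- Only finitely many places of `F` ramify in `E` (prime factors of the different; private copy of the tree's
`finite_setOf_not_isUnramifiedIn`, as in ★ `LocalUnitaryGroupSimilitudeLevel`). [folklore] -/
private theorem finite_setOf_not_isUnramifiedIn_congr :
    {v : HeightOneSpectrum (𝓞 F) | ¬ Algebra.IsUnramifiedIn (𝓞 E) v.asIdeal}.Finite := by
  have hD : differentIdeal (𝓞 F) (𝓞 E) ≠ ⊥ := differentIdeal_ne_bot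
  have hfin : {Q : HeightOneSpectrum (𝓞 E) | Q.asIdeal ∣ differentIdeal (𝓞 F) (𝓞 E)}.Finite := Ideal.finite_factors hD
  refine (hfin.image fun Q => Q.under (𝓞 F)).subset ?_
  intro q hq
  simp only [Set.mem_setOf_eq, Algebra.IsUnramifiedIn, not_forall] at hq
  obtain ⟨Q, hQprime, hQover, hQunr⟩ := hq
  haveI := hQprime
  have hQne : Q ≠ ⊥ := Ideal.ne_bot_of_liesOver_of_ne_bot q.ne_bot Q
  refine ⟨⟨Q, hQprime, hQne⟩, ?_, ?_⟩
  · exact dvd_differentIdeal_iff.mpr hQunr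
  · exact HeightOneSpectrum.ext hQover.over.symm

/-- **Level matching by a form congruence at almost every non-split place** (`c ≠ 1`, `J` `c`-hermitian, `det J` a unit): for all `v`
outside a finite set (the places ramified in `E` and those with `J_w ∉ GL_N(𝒪_w)`), IF `v` is non-split then some similitude `T ∈ GL_N(E_v)`
onto `a • Φ_N` conjugates `U(J)(𝒪_v)` onto `U(Φ_N)(𝒪_v)`. [cite: Rogawski1990, §14.2 p. 233] [cite: Jacobowitz1962, §7 Thm. 7.1] -/
theorem eventually_forall_smul_eq_exists_localFormCongr_levelMatching (hc : c ≠ 1) (hJh : (J.map c)ᵀ = J) (hJd : IsUnit J.det) :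
    ∀ᶠ v : HeightOneSpectrum (𝓞 F) in cofinite, (∀ w : PlacesOver E v, c • w.1 = w.1) →
      ∃ (T : GL (Fin N) (LocalRing E v)) (a : LocalRing E v) (ha : IsUnit a)
        (h : formCongr (conjLocal E c v) T (J.map (algebraMap E (LocalRing E v))) =
          a • (Matrix.of fun i j : Fin N => if i.val + j.val + 1 = N then (1 : E) else 0).map (algebraMap E (LocalRing E v))),
        (∀ w' : PlacesOver E v, localGLPiEquiv E N v T w' ∈ glInt N (w'.1.adicCompletion E)) ∧
        ∀ g : «local» E c N J v,
          (localFormCongr c v T ha h).symm g ∈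
              localIntegralLevel c N (Matrix.of fun i j : Fin N => if i.val + j.val + 1 = N then (1 : E) else 0) v ↔
            g ∈ localIntegralLevel c N J v := by
  have hJu : IsUnit J := (Matrix.isUnit_iff_isUnit_det J).2 hJd
  filter_upwards [eventually_forall_unit_placeForm_mem_glInt (F := F) N J hJu,
    (finite_setOf_not_isUnramifiedIn_congr (F := F) (E := E)).compl_mem_cofinite] with v hint hunr hns
  have hv : Algebra.IsUnramifiedIn (𝓞 E) v.asIdeal := not_not.1 hunr
  obtain ⟨w⟩ := (inferInstance : Nonempty (PlacesOver E v))
  exact exists_localFormCongr_levelMatching_of_smul_eq c hc hJh w (hns w) hv (isUnit_placeForm J hJu w.1) (hint w)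

end Generic

/-! ## §3 The CM dress: `(cmDatumLocalCongr L v T ha h).symm` matches `U(H)(𝒪_v)` with `U(Φ_N)(𝒪_v)` at a.e. non-split `v` -/

section CM

variable (L : Type) [Field L] [NumberField L] [IsCMField L] (N : ℕ) (H : Matrix (Fin N) (Fin N) L)

/-- **LEVEL-MATCHING FORM CONGRUENCE AT ALMOST EVERY NON-SPLIT PLACE, CM dress** — in the binder shape of the non-split clause of ★
`OneDimAutRepH.IsXiLocalFamily`: for `H` hermitian (`ᵗH̄ = H`) with `det H` a unit, for all but finitely many finite places `v` of `L⁺`, if `v`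
is non-split in `L` there are `T ∈ GL_N(L ⊗ L⁺_v)`, a unit `a` and `h : ᵗT̄ · H_v · T = a • (Φ_N)_v` such that the identification
`(cmDatumLocalCongr L v T ha h).symm : U(H)(L⁺_v) ≃ₜ* U(Φ_N)(L⁺_v)` satisfies `ψ g ∈ U(Φ_N)(𝒪_v) ↔ g ∈ U(H)(𝒪_v)`.
[cite: Rogawski1990, §14.2 p. 233] [cite: Jacobowitz1962, §7 Thm. 7.1] -/
theorem eventually_exists_cmDatumLocalCongr_levelMatching (hH : (H.map (cmConjRingHom L))ᵀ = H) (hHd : IsUnit H.det) :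
    ∀ᶠ v : HeightOneSpectrum (𝓞 ↥(maximalRealSubfield L)) in cofinite,
      (∀ w : PlacesOver L v, IsCMField.complexConj L • w.1 = w.1) →
        ∃ (T : GL (Fin N) (LocalRing L v)) (a : LocalRing L v) (ha : IsUnit a)
          (h : formCongr (conjLocal L (IsCMField.complexConj L) v) T (H.map (algebraMap L (LocalRing L v))) =
            a • (Matrix.of fun i j : Fin N => if i.val + j.val + 1 = N then (1 : L) else 0).map (algebraMap L (LocalRing L v))),
          ∀ g : (cmDatum L N H).Local v,
            (cmDatumLocalCongr L v T ha h).symm g ∈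
                cmLocalIntegralLevel L N (Matrix.of fun i j : Fin N => if i.val + j.val + 1 = N then (1 : L) else 0) v ↔
              g ∈ cmLocalIntegralLevel L N H v := by
  filter_upwards [eventually_forall_smul_eq_exists_localFormCongr_levelMatching (IsCMField.complexConj L)
    (IsCMField.complexConj_ne_one L) ((map_cmConjRingHom_eq_map_complexConj L H) ▸ hH) hHd] with v hv hns
  obtain ⟨T, a, ha, h, -, hlev⟩ := hv hns
  exact ⟨T, a, ha, h, hlev⟩

/-- The same with the componentwise integrality of `T` recorded (`T_w ∈ GL_N(𝒪_w)` for every `w ∣ v`). [cite: Rogawski1990, §14.2 p. 233] -/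
theorem eventually_exists_cmDatumLocalCongr_levelMatching' (hH : (H.map (cmConjRingHom L))ᵀ = H) (hHd : IsUnit H.det) :
    ∀ᶠ v : HeightOneSpectrum (𝓞 ↥(maximalRealSubfield L)) in cofinite,
      (∀ w : PlacesOver L v, IsCMField.complexConj L • w.1 = w.1) →
        ∃ (T : GL (Fin N) (LocalRing L v)) (a : LocalRing L v) (ha : IsUnit a)
          (h : formCongr (conjLocal L (IsCMField.complexConj L) v) T (H.map (algebraMap L (LocalRing L v))) =
            a • (Matrix.of fun i j : Fin N => if i.val + j.val + 1 = N then (1 : L) else 0).map (algebraMap L (LocalRing L v))),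
          (∀ w : PlacesOver L v, localGLPiEquiv L N v T w ∈ glInt N (w.1.adicCompletion L)) ∧
          ∀ g : (cmDatum L N H).Local v,
            (cmDatumLocalCongr L v T ha h).symm g ∈
                cmLocalIntegralLevel L N (Matrix.of fun i j : Fin N => if i.val + j.val + 1 = N then (1 : L) else 0) v ↔
              g ∈ cmLocalIntegralLevel L N H v := by
  filter_upwards [eventually_forall_smul_eq_exists_localFormCongr_levelMatching (IsCMField.complexConj L)
    (IsCMField.complexConj_ne_one L) ((map_cmConjRingHom_eq_map_complexConj L H) ▸ hH) hHd] with v hv hns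
  exact hv hns

/-- **`N = 3`, spelled with ★ `Rogawski1990.qsForm L` ∕ `Gqs L v`** (the tokens of ★ `IsXiLocalFamily` and of the `Theorems/F0P3*` instances; `qsForm` is
an `abbrev` of the literal, so this is the previous theorem at `N = 3` by `rfl`). [cite: Rogawski1990, §14.2 p. 233] -/
theorem eventually_exists_cmDatumLocalCongr_levelMatching_three (H₃ : Matrix (Fin 3) (Fin 3) L)
    (hH : (H₃.map (cmConjRingHom L))ᵀ = H₃) (hHd : IsUnit H₃.det) :
    ∀ᶠ v : HeightOneSpectrum (𝓞 ↥(maximalRealSubfield L)) in cofinite,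
      (∀ w : PlacesOver L v, IsCMField.complexConj L • w.1 = w.1) →
        ∃ (T : GL (Fin 3) (LocalRing L v)) (a : LocalRing L v) (ha : IsUnit a)
          (h : formCongr (conjLocal L (IsCMField.complexConj L) v) T (H₃.map (algebraMap L (LocalRing L v))) =
            a • (Rogawski1990.qsForm L).map (algebraMap L (LocalRing L v))),
          ∀ g : (cmDatum L 3 H₃).Local v,
            (cmDatumLocalCongr L v T ha h).symm g ∈ cmLocalIntegralLevel L 3 (Rogawski1990.qsForm L) v ↔
              g ∈ cmLocalIntegralLevel L 3 H₃ v :=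
  eventually_exists_cmDatumLocalCongr_levelMatching L 3 H₃ hH hHd

end CM

end UnitaryGroup

end Literature.NumberTheory.Automorphic

end
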